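import Summits.AtomisticToContinuum.Crystallization.Theorems.ThreeConeCertificateSlackRigidityPricedFloorsMeasurability2
import Summits.AtomisticToContinuum.Crystallization.Theorems.ThreeConeCertificateSlackRigidityPricedFloorsContinuity2
import Summits.AtomisticToContinuum.Crystallization.Theorems.ThreeConeCertificateSlackRigidityPricedFloorsLayerEnergy
import HarnessLib

/-!
# `SlackRigidity` (stmt-AtomisticToContinuum-11960), line `priced-floors-palm-exactification`, stub S3
# (`stub_layeredMeanSelection`), fault identification package (FI3): the measurable competitor-energy
# and fault functionals and their identification on fitted samples

Lead c19, worker W14.  The mean fault-exclusion argument `SlackRigidityPricedFloorsFaults.lms_faults_ae_zero`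
consumes two bounded Giry-measurable functionals of measures on `ℝ³`: a "competitor energy" `Hc` and a
"fault" functional `F ∈ [0, 2]`.  They are built here from the DATA functionals

* `HcE e = Φ₀(a) + Σ'_{m ≠ 0} Φ(a, z m, L_alt m)` (root layer-cake energy of the restacked data
  `(a, alternatingHagg, z)`), continuous on the compact normal-form data
  (`SlackRigidityPricedFloorsContinuity.lms_continuousOn_layerEnergy_fixedLabels`), hence bounded there;
* `faultE e = 1[s 1 ≠ −s 0] + 1[s(−2) ≠ −s(−1)]` (stacking faults next to the root layer), locally
  constant in the word, hence continuous on the whole data space,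

through the measurability package: `SlackRigidityPricedFloorsMeasurability.lms_measurable_dataSup_joint`
(u.s.c. data functionals; used for `HcE`, which is only continuous on the normal data) and
`lms_exists_measurable_dataSup` (continuous data functionals; used for `faultE`) produce measurable
functionals of measures agreeing at `count|S` with the supremum `dataSup φ S` of `φ` over the data
fitting `S`; the results are clamped to `[−K₀, K₀]` resp. `[0, 2]`.  IDENTIFICATION: under the
hypothesis (U) that any two data fitting the same set are related by the data relation REL (same
spacing; heights equal or reversed; word equal or reversed, up to a global sign — the registered
sub-goal `lms_rel_of_fits` of another worker), both `HcE` (`competitorEnergy_reverse`) and `faultE` are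
constant on the data fitting `S`, so `dataSup = ` the common value and
`Hc (count|S) = HcE e`, `F (count|S) = faultE e` for EVERY `e` fitting a rooted `δ`-separated `S`.
Registered sub-goal `lms_exists_fault_functionals`.  All `[folklore]`.
-/

noncomputable section

open MeasureTheory Filter Set
open scoped ENNReal BigOperators Topology

namespace Summit.AtomisticToContinuum.Crystallization.Theorems.SlackRigidityPricedFloorsFaultIdent

open Literature.Probability.Process
open Literature.MathematicalPhysics.StatisticalMechanics
open Summit.AtomisticToContinuum.Crystallization.Theorems.SlackRigidityPricedFloors
open Summit.AtomisticToContinuum.Crystallization.Theorems.SlackRigidityPricedFloorsMeasurability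
open Summit.AtomisticToContinuum.Crystallization.Theorems.SlackRigidityPricedFloorsContinuity
open Summit.AtomisticToContinuum.Crystallization.Theorems.SlackRigidityPricedFloorsLayerEnergy

/-! ## The fault functional of the data -/

/-- **The fault count is continuous on the data space** (it factors through finitely many word
coordinates, valued in the discrete `ℤ⁴`). [folklore] -/
theorem continuous_faultE : Continuous fun e : LData =>
    (if e.2.2.1 1 = -e.2.2.1 0 then (0 : ℝ) else 1) + (if e.2.2.1 (-2) = -e.2.2.1 (-1) then (0 : ℝ) else 1) := by
  have hs : ∀ k : ℤ, Continuous fun e : LData => e.2.2.1 k :=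
    fun k => (continuous_apply k).comp (continuous_fst.comp (continuous_snd.comp continuous_snd))
  have h4 : Continuous fun e : LData => (e.2.2.1 1, e.2.2.1 0, e.2.2.1 (-2), e.2.2.1 (-1)) :=
    (hs 1).prodMk ((hs 0).prodMk ((hs (-2)).prodMk (hs (-1))))
  have hf : Continuous fun q : ℤ × ℤ × ℤ × ℤ =>
      (if q.1 = -q.2.1 then (0 : ℝ) else 1) + (if q.2.2.1 = -q.2.2.2 then (0 : ℝ) else 1) :=
    continuous_of_discreteTopology
  exact hf.comp h4

/-- The fault count takes values in `[0, 2]`. [folklore] -/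
theorem faultE_mem_Icc (s : ℤ → ℤ) :
    0 ≤ (if s 1 = -s 0 then (0 : ℝ) else 1) + (if s (-2) = -s (-1) then (0 : ℝ) else 1) ∧
      (if s 1 = -s 0 then (0 : ℝ) else 1) + (if s (-2) = -s (-1) then (0 : ℝ) else 1) ≤ 2 := by
  constructor <;> split_ifs <;> norm_num

/-- **The fault count is invariant under the data relation** (word equal or reversed `m ↦ s(−m−1)`,
up to a global sign): the pair of conditions `{s 1 = −s 0, s(−2) = −s(−1)}` is mapped to itself.
[folklore] -/
theorem faultE_eq_of_rel {s s' : ℤ → ℤ}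
    (h : (s' = s ∨ s' = fun m => -s m) ∨ (s' = (fun m => s (-m - 1)) ∨ s' = fun m => -s (-m - 1))) :
    (if s' 1 = -s' 0 then (0 : ℝ) else 1) + (if s' (-2) = -s' (-1) then (0 : ℝ) else 1) =
      (if s 1 = -s 0 then (0 : ℝ) else 1) + (if s (-2) = -s (-1) then (0 : ℝ) else 1) := by
  have e1 : (-(1 : ℤ) - 1) = -2 := by norm_num
  have e2 : (-(0 : ℤ) - 1) = -1 := by norm_num
  have e3 : (-(-2 : ℤ) - 1) = 1 := by norm_num
  have e4 : (-(-1 : ℤ) - 1) = 0 := by norm_num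
  rcases h with (rfl | rfl) | (rfl | rfl)
  · rfl
  · have i1 : (-s 1 = -(-s 0)) ↔ (s 1 = -s 0) := by constructor <;> intro h <;> linarith
    have i2 : (-s (-2) = -(-s (-1))) ↔ (s (-2) = -s (-1)) := by constructor <;> intro h <;> linarith
    simp only [i1, i2]
  · simp only [e1, e2, e3, e4]
    rw [add_comm]
  · simp only [e1, e2, e3, e4]
    have i1 : (-s 1 = -(-s 0)) ↔ (s 1 = -s 0) := by constructor <;> intro h <;> linarith
    have i2 : (-s (-2) = -(-s (-1))) ↔ (s (-2) = -s (-1)) := by constructor <;> intro h <;> linarith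
    simp only [i1, i2]
    rw [add_comm]

/-! ## The competitor energy of the data -/

/-- **The competitor energy is continuous on the normal-form data** (as a function on the subtype):
`lms_continuousOn_layerEnergy_fixedLabels` with the constant label assignment `L_alt`. [folklore] -/
theorem continuousOn_HcE : ContinuousOn (fun e : LData => inLayerInteraction lennardJones e.2.1 +
      ∑' m : ℤ, if m = 0 then (0 : ℝ) else layerInteraction lennardJones e.2.1 (e.2.2.2 m) (haggLabel alternatingHagg m) 1)
    {e | IsNormalData e} :=
  (lms_continuousOn_layerEnergy_fixedLabels fun m => haggLabel alternatingHagg m).mono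
    fun _ he => ⟨he.2.1.1, he.2.1.2.1, he.2.1.2.2.2, he.2.2⟩

/-- Continuity of the competitor energy on the subtype of normal-form data. [folklore] -/
theorem continuous_HcE_subtype : Continuous fun x : {e : LData // IsNormalData e} =>
    inLayerInteraction lennardJones x.1.2.1 +
      ∑' m : ℤ, if m = 0 then (0 : ℝ) else layerInteraction lennardJones x.1.2.1 (x.1.2.2.2 m) (haggLabel alternatingHagg m) 1 :=
  continuousOn_iff_continuous_restrict.1 continuousOn_HcE

/-- **The competitor energy is bounded on the normal-form data** (continuous on a compact set).
[folklore] -/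
theorem exists_bound_HcE : ∃ K₀ : ℝ, 0 ≤ K₀ ∧ ∀ e : LData, IsNormalData e →
    |inLayerInteraction lennardJones e.2.1 +
      ∑' m : ℤ, if m = 0 then (0 : ℝ) else layerInteraction lennardJones e.2.1 (e.2.2.2 m) (haggLabel alternatingHagg m) 1| ≤ K₀ := by
  obtain ⟨K, hK⟩ := isCompact_setOf_isNormalData.exists_bound_of_continuousOn continuousOn_HcE
  refine ⟨max K 0, le_max_right _ _, fun e he => le_trans ?_ (le_max_left _ _)⟩
  have h := hK e he
  rwa [Real.norm_eq_abs] at h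

/-- **The competitor energy is invariant under the data relation** (it depends on `(a, z)` only and is
invariant under the reversal `z ↦ (m ↦ −z(−m))`, `competitorEnergy_reverse`). [folklore] -/
theorem HcE_eq_of_rel {e e' : LData}
    (h : e'.2.1 = e.2.1 ∧ ((e'.2.2.2 = e.2.2.2 ∧ (e'.2.2.1 = e.2.2.1 ∨ e'.2.2.1 = fun m => -e.2.2.1 m)) ∨ (e'.2.2.2 = (fun m => -e.2.2.2 (-m)) ∧ (e'.2.2.1 = (fun m => e.2.2.1 (-m - 1)) ∨ e'.2.2.1 = fun m => -e.2.2.1 (-m - 1))))) :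
    (inLayerInteraction lennardJones e'.2.1 +
        ∑' m : ℤ, if m = 0 then (0 : ℝ) else layerInteraction lennardJones e'.2.1 (e'.2.2.2 m) (haggLabel alternatingHagg m) 1) =
      inLayerInteraction lennardJones e.2.1 +
        ∑' m : ℤ, if m = 0 then (0 : ℝ) else layerInteraction lennardJones e.2.1 (e.2.2.2 m) (haggLabel alternatingHagg m) 1 := by
  obtain ⟨ha, hz⟩ := h
  rcases hz with ⟨hz, -⟩ | ⟨hz, -⟩
  · rw [ha, hz]
  · rw [ha, hz]
    exact congrArg _ (competitorEnergy_reverse e.2.1 e.2.2.2)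

/-! ## The registered sub-goal -/

/-- **Measurable competitor-energy and fault functionals, identified on fitted samples** (registered
sub-goal `lms_exists_fault_functionals`): see the module docstring. [folklore] -/
theorem lms_exists_fault_functionals : ∀ (δ : ℝ), 0 < δ → (∀ (S : Set E3) (e e' : LData), Fits S e → Fits S e' → e'.2.1 = e.2.1 ∧ ((e'.2.2.2 = e.2.2.2 ∧ (e'.2.2.1 = e.2.2.1 ∨ e'.2.2.1 = fun m => -e.2.2.1 m)) ∨ (e'.2.2.2 = (fun m => -e.2.2.2 (-m)) ∧ (e'.2.2.1 = (fun m => e.2.2.1 (-m - 1)) ∨ e'.2.2.1 = fun m => -e.2.2.1 (-m - 1))))) → ∃ Hc F : Measure E3 → ℝ, Measurable Hc ∧ Measurable F ∧ ∃ K₀ : ℝ, (∀ μ, |Hc μ| ≤ K₀) ∧ (∀ μ, 0 ≤ F μ ∧ F μ ≤ 2) ∧ ∀ (S : Set E3) (e : LData), (0 : E3) ∈ S → (∀ x ∈ S, ∀ y ∈ S, x ≠ y → δ ≤ dist x y) → Fits S e → Hc ((Measure.count : Measure E3).restrict S) = inLayerInteraction lennardJones e.2.1 + (∑' m : ℤ,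 if m = 0 then (0 : ℝ) else layerInteraction lennardJones e.2.1 (e.2.2.2 m) (haggLabel alternatingHagg m) 1) ∧ F ((Measure.count : Measure E3).restrict S) = (if e.2.2.1 1 = -e.2.2.1 0 then (0 : ℝ) else 1) + (if e.2.2.1 (-2) = -e.2.2.1 (-1) then (0 : ℝ) else 1) := by
  intro δ hδ hrel
  haveI : Fact (0 < δ) := ⟨hδ⟩
  -- the data functionals
  set HcE : LData → ℝ := fun e => inLayerInteraction lennardJones e.2.1 +
    ∑' m : ℤ, if m = 0 then (0 : ℝ) else layerInteraction lennardJones e.2.1 (e.2.2.2 m) (haggLabel alternatingHagg m) 1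
    with hHcE
  set fE : LData → ℝ := fun e =>
    (if e.2.2.1 1 = -e.2.2.1 0 then (0 : ℝ) else 1) + (if e.2.2.1 (-2) = -e.2.2.1 (-1) then (0 : ℝ) else 1)
    with hfE
  obtain ⟨K₀, hK₀, hbd⟩ := exists_bound_HcE
  -- measurable extensions of `dataSup HcE`, `dataSup fE` to measures
  have hclosed : ∀ c : ℝ, IsClosed {x : {e : LData // IsNormalData e} × E3 | c ≤ (fun p : LData × E3 => HcE p.1) (x.1.1, x.2)} :=
    fun c => isClosed_le continuous_const (continuous_HcE_subtype.comp continuous_fst)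
  obtain ⟨-, F₁, hF₁m, hF₁⟩ := lms_measurable_dataSup_joint δ (fun p : LData × E3 => HcE p.1) hclosed
  obtain ⟨F₂, hF₂m, hF₂⟩ := lms_exists_measurable_dataSup δ fE continuous_faultE
  refine ⟨fun μ => max (-K₀) (min K₀ (F₁ (μ, 0))), fun μ => max 0 (min 2 (F₂ μ)), ?_, ?_, K₀, ?_, ?_, ?_⟩
  · exact measurable_const.max (measurable_const.min (hF₁m.comp (measurable_id.prodMk measurable_const)))
  · exact measurable_const.max (measurable_const.min hF₂m)
  · intro μ
    rw [abs_le]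
    exact ⟨le_max_left _ _, max_le (by linarith) (min_le_left _ _)⟩
  · intro μ
    exact ⟨le_max_left _ _, max_le (by norm_num) (min_le_left _ _)⟩
  · intro S e h0 hsep he
    -- the sample as a rooted hard-core configuration
    set Sc : LocalConfig.RootedHardCoreConfig E3 δ := ⟨LocalConfig.mk S, h0, hsep⟩ with hSc
    have hcoe : ((Sc.1 : LocalConfig E3) : Set E3) = S := rfl
    have hμ : (Sc.1 : LocalConfig E3).toMeasure = (Measure.count : Measure E3).restrict S := rfl
    have h1 := hF₁ Sc 0
    have h2 := hF₂ Sc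
    rw [hμ, hcoe] at h1 h2
    -- presentation invariance under (U)
    have hinv1 : ∀ e', Fits S e' → HcE e' = HcE e := fun e' he' => HcE_eq_of_rel (hrel S e e' he he')
    have hinv2 : ∀ e', Fits S e' → fE e' = fE e := fun e' he' =>
      faultE_eq_of_rel (by
        obtain ⟨-, h⟩ := hrel S e e' he he'
        rcases h with ⟨-, hs⟩ | ⟨-, hs⟩
        · exact Or.inl hs
        · exact Or.inr hs)
    have hd1 : sSup ((fun e' => HcE e') '' {e' | Fits S e'}) = HcE e := dataSup_eq_of_forall_eq he hinv1
    have hd2 : dataSup fE S = fE e := dataSup_eq_of_forall_eq he hinv2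
    have hb := abs_le.1 (hbd e he.1)
    have hf := faultE_mem_Icc e.2.2.1
    constructor
    · show max (-K₀) (min K₀ (F₁ ((Measure.count : Measure E3).restrict S, 0))) = HcE e
      rw [h1, hd1, min_eq_right hb.2, max_eq_right hb.1]
    · show max 0 (min 2 (F₂ ((Measure.count : Measure E3).restrict S))) = fE e
      rw [h2, hd2, min_eq_right hf.2, max_eq_right hf.1]

end Summit.AtomisticToContinuum.Crystallization.Theorems.SlackRigidityPricedFloorsFaultIdent

end
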